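import Mathlib
import Summits.Ventures.PercRepro2.SwOutArmThm

/-!
# THE ARM PRINCIPLE FOR THE NEGATIVE-MARK SIDE (blind cell PercRepro2, night-4 g30, 2026-08-28;
proofs/NIGHT4-G30.md §8)

The NEGATIVE-MARK side is `N(p) = negSide ends l h p = {h ∉ H_l, p ∉ C_R(h)}` — the conditioning
is on the RED CLUSTER OF `h` (the vertex `p` is not in it), not on the clusters of `l`.  The
NEGATIVE-MARK DOMINATION (a candidate row, 0 failures on all connected graphs `n ≤ 6`): on `N(p)`
the blue edge set of `h` dominates the red one in the rigid form (`SwAllNeg`; by the colour swap: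
on `{h ∉ H_l, p ∈ C_R(h)}` the red edge set dominates the blue one).  g10's arm principle applies
verbatim: flipping red arms to blue SHRINKS the red cluster of `h`
(`cluster_flip_of_armClosed`), so `p ∉ C_R(h)` survives and the conditioning pulls back to a lower
set of every orbit cube (`flip_mem_negSide_of_armClosed_red`, `orbitReal_mem_negSide_of_le`);
the core-free criterion needs no exemption at `p` (a core lies in `C_R(h)`).  Hence
`card_orbit_le_neg`, `card_coreFree_le_neg`, `rigidOK_neg_of_coreFree`, `rigidOK_neg_of_outEdges'`
and, on the whole graph, **`card_le_neg_of_outEdges`** / **`swAllNeg_of_outEdges`**: the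
negative-mark domination on every graph in which every vertex other than `l, h, p` is joined to
`l` or isolated — the first kernel theorem of the candidate (g10's class).
-/

namespace Summit.Ventures.PercRepro2

namespace LocRows

open Hull

variable {V : Type*} {E : Type*} [Fintype E] [DecidableEq E]

open scoped Classical

variable {ends : E → Sym2 V}

section Side

variable (ends)

/-- The NEGATIVE-MARK side `N(p) = {h ∉ H_l, p ∉ C_R(h)}`. -/
noncomputable def negSide (l h p : V) : Finset (Config E) :=
  Finset.univ.filter fun ζ => h ∉ hull ends ζ l ∧ p ∉ cluster ends ζ h

/-- `N(p) ∩ outClass`. -/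
noncomputable def negOutSide (l h p : V) (U : Set V) (ξ : Config E) : Finset (Config E) :=
  negSide ends l h p ∩ outClass ends U h ξ

/-- The core-free part of the negative-mark side of a class. -/
noncomputable def negCoreFreePart (l h p : V) (U : Set V) (ξ : Config E) : Finset (Config E) :=
  (negOutSide ends l h p U ξ).filter fun ζ => CoreFree ends ζ h

/-- **The negative-mark domination, rigid form**: an injection of `N(p)` into itself under which
every red edge inside the red cluster of `h` of the source is blue in the image. -/
def SwAllNeg (l h p : V) : Prop :=
  ∃ f : {ζ // ζ ∈ negSide ends l h p} → Config E, Function.Injective f ∧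
    ∀ x, f x ∈ negSide ends l h p ∧
      ∀ e, e ∈ within ends (cluster ends x.1 h) → x.1 e = true → f x e = false

variable {ends}

/-- Membership in the negative-mark side. -/
lemma mem_negSide {l h p : V} {ζ : Config E} :
    ζ ∈ negSide ends l h p ↔ h ∉ hull ends ζ l ∧ p ∉ cluster ends ζ h := by
  simp only [negSide, Finset.mem_filter, Finset.mem_univ, true_and]

/-- Membership in `negOutSide`. -/
lemma mem_negOutSide {l h p : V} {U : Set V} {ξ ζ : Config E} :
    ζ ∈ negOutSide ends l h p U ξ ↔ ζ ∈ negSide ends l h p ∧ ζ ∈ outClass ends U h ξ := by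
  simp only [negOutSide, Finset.mem_inter]

/-- On the negative-mark side the hull of `h` avoids `l`. -/
lemma l_notMem_hull_of_mem_negSide {l h p : V} {ζ : Config E} (hζ : ζ ∈ negSide ends l h p) :
    l ∉ hull ends ζ h := by
  rw [mem_negSide] at hζ
  intro hl
  apply hζ.1
  rcases hl with hl | hl
  · exact Or.inl (conn_symm hl)
  · exact Or.inr (conn_symm hl)

end Side

section Flip

variable {ζ : Config E} {h : V} {P : Set V}

/-- **Flipping red arms to blue keeps the negative-mark side**: the red cluster of `h` shrinks. -/
theorem flip_mem_negSide_of_armClosed_red {U : Set V} {l p : V} (hc : CoreFree ends ζ h)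
    (hP : ArmClosed ends ζ h P) (hPT : P ⊆ cluster ends ζ h) (hUP : P ⊆ U) (hl : l ∉ U)
    (hQ : ζ ∈ negSide ends l h p) : flip ends P ζ ∈ negSide ends l h p := by
  have hlP : l ∉ P := fun h' => hl (hUP h')
  rw [mem_negSide] at hQ ⊢
  simp only [hull, Set.mem_union, not_or] at hQ ⊢
  obtain ⟨⟨hhA, hhB⟩, hp⟩ := hQ
  refine ⟨⟨h_notMem_cluster_flip_of_armClosed_red hc hP hPT hhA, ?_⟩, ?_⟩
  · exact fun h' => hhB (cluster_blue_flip_subset_of_armClosed_red hc hP hPT hlP hhB h')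
  · rw [cluster_flip_of_armClosed hc hP]
    rintro (⟨hpT, -⟩ | ⟨hpP, -⟩)
    · exact hp hpT
    · exact hp (hPT hpP)

end Flip

section OrbitCube

variable {ζ : Config E} {h : V} (hc : CoreFree ends ζ h)
include hc

/-- **The negative-mark conditioning pulls back to a lower set of the orbit cube.** -/
theorem orbitReal_mem_negSide_of_le {U : Set V} {ξ : Config E} {l p : V}
    (hζ : ζ ∈ outClass ends U h ξ) (hl : l ∉ U) {ω ω' : Config (arms ends ζ h)} (hω : ω ≤ ω')
    (hQ : orbitReal ends ζ h ω' ∈ negSide ends l h p) :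
    orbitReal ends ζ h ω ∈ negSide ends l h p := by
  rw [orbitReal_eq_flip_of_le hω]
  have hD : ArmClosed ends (orbitReal ends ζ h ω') h
      {x | ∃ P : arms ends ζ h, (ω P = false ∧ ω' P = true) ∧ x ∈ P.1} :=
    armClosed_of_hull_eq (hull_orbitReal hc ω') (armClosed_armsSel _)
  refine flip_mem_negSide_of_armClosed_red (coreFree_orbitReal hc ω') hD ?_ ?_ hl hQ
  · rintro x ⟨P, hP, hxP⟩
    rw [cluster_orbitReal hc]
    refine ⟨(mem_hull_sdiff_of_mem_arms P.2 hxP).1, ?_⟩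
    rintro ⟨Q, hQ, hxQ⟩
    have : Q = P := Subtype.ext (arms_eq_of_mem Q.2 P.2 hxQ hxP)
    subst this
    rw [hP.2] at hQ; exact absurd hQ (by decide)
  · rintro x ⟨P, _, hxP⟩
    exact (mem_outClass.1 hζ).2 (mem_hull_sdiff_of_mem_arms P.2 hxP).1

/-- **The rigid counting inequality on an orbit, negative-mark side.** -/
theorem card_orbit_le_neg (hloop : ∀ e, ends e ≠ s(h, h)) {U : Set V} {ξ : Config E} {l p : V}
    (hζ : ζ ∈ outClass ends U h ξ) (hl : l ∉ U) {𝓔 : Set (Set E)} (h𝓔 : IsUpperSet 𝓔) :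
    ((orbit ends ζ h).filter fun ζ' =>
        ζ' ∈ negSide ends l h p ∧ redEdges ends ζ' h ∈ 𝓔).card ≤
      ((orbit ends ζ h).filter fun ζ' =>
        ζ' ∈ negSide ends l h p ∧ blueEdges ends ζ' h ∈ 𝓔).card := by
  have key := card_le_of_cube_edges (ends := ends) (orbitReal ends ζ h) orbitReal_injective
    (orbit ends ζ h) (fun ζ' => by simp only [orbit, Finset.mem_image, Finset.mem_univ, true_and])
    (↑(negSide ends l h p))
    (fun ω' ω hω hQ => orbitReal_mem_negSide_of_le hc hζ hl hω hQ) h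
    (fun 𝓔' h𝓔' ω ω' hω hω𝓔 => h𝓔' (redEdges_orbitReal_mono hc hω) hω𝓔)
    (fun 𝓔' h𝓔' ω' ω hω hω𝓔 => h𝓔' (blueEdges_orbitReal_anti hc hloop hω) hω𝓔)
    (fun ω => blueEdges_orbitReal_flipAll hc hloop ω) h𝓔
  simpa only [Finset.mem_coe] using key

end OrbitCube

section Sum

variable {U : Set V} {ξ : Config E} {l h p : V}

/-- **THE ARM PRINCIPLE, NEGATIVE-MARK SIDE**: the core-free part of every class satisfies the
rigid counting inequality on `N(p)` (no loop at `h`). -/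
theorem card_coreFree_le_neg (hl : l ∉ U) (hloop : ∀ e, ends e ≠ s(h, h)) {𝓔 : Set (Set E)}
    (h𝓔 : IsUpperSet 𝓔) :
    ((negCoreFreePart ends l h p U ξ).filter fun ζ => redEdges ends ζ h ∈ 𝓔).card ≤
      ((negCoreFreePart ends l h p U ξ).filter fun ζ => blueEdges ends ζ h ∈ 𝓔).card := by
  let can : Config E → Config E := fun ζ => allRed ends ζ h
  let S₀ : Finset (Config E) := (negCoreFreePart ends l h p U ξ).image can
  have hmapR : ∀ ζ ∈ (negCoreFreePart ends l h p U ξ).filter fun ζ => redEdges ends ζ h ∈ 𝓔,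
      can ζ ∈ S₀ := fun ζ hζ => Finset.mem_image_of_mem can (Finset.mem_filter.1 hζ).1
  have hmapB : ∀ ζ ∈ (negCoreFreePart ends l h p U ξ).filter fun ζ => blueEdges ends ζ h ∈ 𝓔,
      can ζ ∈ S₀ := fun ζ hζ => Finset.mem_image_of_mem can (Finset.mem_filter.1 hζ).1
  rw [Finset.card_eq_sum_card_fiberwise hmapR, Finset.card_eq_sum_card_fiberwise hmapB]
  refine Finset.sum_le_sum fun ζ₀ hζ₀ => ?_
  obtain ⟨ζ₁, hζ₁, rfl⟩ := Finset.mem_image.1 hζ₀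
  have hζ₁' := Finset.mem_filter.1 hζ₁
  have hc₁ : CoreFree ends ζ₁ h := hζ₁'.2
  have hcl₁ : ζ₁ ∈ outClass ends U h ξ := (mem_negOutSide.1 hζ₁'.1).2
  have hc₀ : CoreFree ends (allRed ends ζ₁ h) h := coreFree_allRed hc₁
  have hcl₀ : allRed ends ζ₁ h ∈ outClass ends U h ξ := allRed_mem_outClass hcl₁ hc₁
  have hfib : ∀ P : Config E → Prop,
      ((negCoreFreePart ends l h p U ξ).filter fun ζ => P ζ).filter (fun ζ => can ζ = can ζ₁) =
        (orbit ends (allRed ends ζ₁ h) h).filter fun ζ' =>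
          ζ' ∈ negSide ends l h p ∧ P ζ' := by
    intro P
    ext ζ'
    simp only [Finset.mem_filter, negCoreFreePart, orbit, Finset.mem_image, Finset.mem_univ,
      true_and, mem_negOutSide, can]
    constructor
    · rintro ⟨⟨⟨⟨hQ, _⟩, hc'⟩, hP⟩, hcan⟩
      obtain ⟨ω, hω⟩ := exists_orbitReal_eq hc' hcan
      exact ⟨⟨ω, hω⟩, hQ, hP⟩
    · rintro ⟨⟨ω, rfl⟩, hQ, hP⟩
      refine ⟨⟨⟨⟨hQ, orbitReal_mem_outClass hc₀ hcl₀ ω⟩, coreFree_orbitReal hc₀ ω⟩, hP⟩, ?_⟩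
      rw [allRed_orbitReal hc₀ ω, allRed_idem hc₁]
  rw [hfib, hfib]
  exact card_orbit_le_neg hc₀ hloop hcl₀ hl h𝓔

/-- **A class all of whose `N(p)`-configurations are core-free satisfies the rigid inequality on
the negative-mark side.** -/
theorem rigidOK_neg_of_coreFree (hl : l ∉ U) (hloop : ∀ e, ends e ≠ s(h, h))
    (hcf : ∀ ζ ∈ negOutSide ends l h p U ξ, CoreFree ends ζ h) {𝓔 : Set (Set E)}
    (h𝓔 : IsUpperSet 𝓔) :
    ((negOutSide ends l h p U ξ).filter fun ζ => redEdges ends ζ h ∈ 𝓔).card ≤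
      ((negOutSide ends l h p U ξ).filter fun ζ => blueEdges ends ζ h ∈ 𝓔).card := by
  have heq : negCoreFreePart ends l h p U ξ = negOutSide ends l h p U ξ := by
    ext ζ
    simp only [negCoreFreePart, Finset.mem_filter]
    exact ⟨fun h' => h'.1, fun h' => ⟨h', hcf ζ h'⟩⟩
  have := card_coreFree_le_neg (ends := ends) (ξ := ξ) (p := p) hl hloop h𝓔
  rw [heq] at this
  exact this

/-- When every vertex of `U ∖ {h, p}` has an outside edge or no edge, every `N(p)`-configuration
of the class is core-free (a core carries no outside edge; a core at `p` lies in `C_R(h)`). -/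
theorem coreFree_of_outEdges_neg
    (hout : ∀ x ∈ U, x ≠ h → x ≠ p → (∃ e y, ends e = s(x, y) ∧ y ∉ U) ∨ (∀ e, x ∉ ends e))
    {ζ : Config E} (hζ : ζ ∈ negOutSide ends l h p U ξ) : CoreFree ends ζ h := by
  intro x hxT hxTp
  by_contra hxh
  have hQ := (mem_negOutSide.1 hζ).1
  have hcl := (mem_negOutSide.1 hζ).2
  rw [mem_negSide] at hQ
  have hxU : x ∈ U := (mem_outClass.1 hcl).2 (Or.inl hxT)
  by_cases hxp : x = p
  · subst hxp
    exact hQ.2 hxT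
  rcases hout x hxU hxh hxp with ⟨e, y, hxy, hyU⟩ | hiso
  · cases he : ζ e with
    | true => exact hyU ((mem_outClass.1 hcl).2 (Or.inl (mem_cluster_of_edge hxT he hxy)))
    | false =>
      have he' : blue ζ e = true := by rw [blue_eq_true_iff]; exact he
      exact hyU ((mem_outClass.1 hcl).2 (Or.inr (mem_cluster_of_edge hxTp he' hxy)))
  · obtain ⟨e, hxe⟩ := exists_edge_of_mem_cluster hxT hxh
    exact hiso e hxe

/-- **The rigid inequality on the negative-mark side of every class of a region whose vertices
other than `h, p` carry an outside edge or no edge** (no loop at `h`). -/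
theorem rigidOK_neg_of_outEdges' (hl : l ∉ U) (hloop : ∀ e, ends e ≠ s(h, h))
    (hout : ∀ x ∈ U, x ≠ h → x ≠ p → (∃ e y, ends e = s(x, y) ∧ y ∉ U) ∨ (∀ e, x ∉ ends e))
    {𝓔 : Set (Set E)} (h𝓔 : IsUpperSet 𝓔) :
    ((negOutSide ends l h p U ξ).filter fun ζ => redEdges ends ζ h ∈ 𝓔).card ≤
      ((negOutSide ends l h p U ξ).filter fun ζ => blueEdges ends ζ h ∈ 𝓔).card :=
  rigidOK_neg_of_coreFree hl hloop (fun _ hζ => coreFree_of_outEdges_neg hout hζ) h𝓔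

end Sum

section Graph

variable {l h p : V}

/-- **Gluing the classes of the region `{l}ᶜ`** on the negative-mark side. -/
theorem card_le_neg_of_classes (hlh : l ≠ h)
    (hcls : ∀ ξ : Config E, ∀ 𝓔 : Set (Set E), IsUpperSet 𝓔 →
      ((negOutSide ends l h p ({l}ᶜ) ξ).filter fun ζ => redEdges ends ζ h ∈ 𝓔).card ≤
        ((negOutSide ends l h p ({l}ᶜ) ξ).filter fun ζ => blueEdges ends ζ h ∈ 𝓔).card)
    (𝓔 : Set (Set E)) (h𝓔 : IsUpperSet 𝓔) :
    ((negSide ends l h p).filter fun ζ => redEdges ends ζ h ∈ 𝓔).card ≤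
      ((negSide ends l h p).filter fun ζ => blueEdges ends ζ h ∈ 𝓔).card := by
  have _hlh := hlh
  set T := negSide ends l h p with hT
  let can : Config E → Config E := outRep ends ({l}ᶜ)
  have hmapR : ∀ ζ ∈ T.filter fun ζ => redEdges ends ζ h ∈ 𝓔, can ζ ∈ T.image can :=
    fun ζ hζ => Finset.mem_image_of_mem can (Finset.mem_filter.1 hζ).1
  have hmapB : ∀ ζ ∈ T.filter fun ζ => blueEdges ends ζ h ∈ 𝓔, can ζ ∈ T.image can :=
    fun ζ hζ => Finset.mem_image_of_mem can (Finset.mem_filter.1 hζ).1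
  rw [Finset.card_eq_sum_card_fiberwise hmapR, Finset.card_eq_sum_card_fiberwise hmapB]
  refine Finset.sum_le_sum fun ξ hξ => ?_
  obtain ⟨ζ₀, -, rfl⟩ := Finset.mem_image.1 hξ
  have hidem : ∀ ζ : Config E, outRep ends ({l}ᶜ) (outRep ends ({l}ᶜ) ζ) = outRep ends ({l}ᶜ) ζ := by
    intro ζ; funext e; simp only [outRep]; split_ifs <;> rfl
  have hfib : ∀ P : Config E → Prop,
      (T.filter fun ζ => P ζ).filter (fun ζ => can ζ = can ζ₀) =
        (negOutSide ends l h p ({l}ᶜ) (can ζ₀)).filter fun ζ => P ζ := by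
    intro P
    ext ζ
    simp only [Finset.mem_filter, mem_negOutSide, mem_outClass, hT]
    constructor
    · rintro ⟨⟨hζ, hP⟩, hcan⟩
      refine ⟨⟨hζ, ?_, ?_⟩, hP⟩
      · intro e he
        rw [← hcan]
        simp only [can, outRep, he, if_false]
      · intro x hx hxl
        simp only [Set.mem_singleton_iff] at hxl
        subst hxl
        exact l_notMem_hull_of_mem_negSide hζ hx
    · rintro ⟨⟨hζ, hagree, -⟩, hP⟩
      refine ⟨⟨hζ, hP⟩, ?_⟩
      show outRep ends ({l}ᶜ) ζ = outRep ends ({l}ᶜ) ζ₀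
      rw [outRep_eq_of_agree (ends := ends) (U := {l}ᶜ) (ζ := outRep ends ({l}ᶜ) ζ₀) (ζ' := ζ) hagree,
        hidem]
  rw [hfib, hfib]
  exact hcls _ 𝓔 h𝓔

/-- **The negative-mark domination on a graph whose vertices other than `l, h, p` are joined to
`l` or isolated** (no loop at `h`): the counting form. -/
theorem card_le_neg_of_outEdges (hlh : l ≠ h) (hloop : ∀ e, ends e ≠ s(h, h))
    (hout : ∀ x, x ≠ l → x ≠ h → x ≠ p → (∃ e, ends e = s(x, l)) ∨ (∀ e, x ∉ ends e))
    (𝓔 : Set (Set E)) (h𝓔 : IsUpperSet 𝓔) :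
    ((negSide ends l h p).filter fun ζ => redEdges ends ζ h ∈ 𝓔).card ≤
      ((negSide ends l h p).filter fun ζ => blueEdges ends ζ h ∈ 𝓔).card := by
  refine card_le_neg_of_classes hlh (fun ξ 𝓔' h𝓔' => ?_) 𝓔 h𝓔
  refine rigidOK_neg_of_outEdges' (ξ := ξ) (by simp) hloop ?_ h𝓔'
  intro x hx hxh hxp
  rcases hout x (by simpa using hx) hxh hxp with ⟨e, he⟩ | hiso
  · exact Or.inl ⟨e, l, he, by simp⟩
  · exact Or.inr hiso

/-- **The negative-mark domination, rigid injection form, on the same graphs** (Hall). -/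
theorem swAllNeg_of_outEdges (hlh : l ≠ h) (hloop : ∀ e, ends e ≠ s(h, h))
    (hout : ∀ x, x ≠ l → x ≠ h → x ≠ p → (∃ e, ends e = s(x, l)) ∨ (∀ e, x ∉ ends e)) :
    SwAllNeg ends l h p :=
  exists_swAll_injection_of_card_le h _ (card_le_neg_of_outEdges hlh hloop hout)

end Graph

end LocRows

end Summit.Ventures.PercRepro2

/-! ## ERRATUM (night-4 g30, 2026-08-28T17:5xZ; proofs/NIGHT4-G30.md §9)

The «negative-mark domination» of the header is NOT a new candidate: `negSide ends l h p` is the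
doubly typed class `gTypedQ ends l h univ univ {S ∣ p ∉ S} ∅ univ` of night-4 g7's doubly typed
row (`GTypedSwAll`, DoublyTypedRowGen.lean; NIGHT4-G7.md §9: «x ∉ C_R(h)» is an admissible
avoided-vertex condition), and `SwAllNeg ends l h p` is that instance of `GTypedSwAll`
(`gTypedSwAll_iff_swAllNeg`, TypedRowClasses).  What this file adds to the row of record is its
arm principle on g10's class (`gTypedSwAll_neg_of_outEdges` through the bridge).  The declarations
above are unchanged.
-/
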